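import Literature.NumberTheory.NumberFields.AmbiguousClassNumberFormula
import HarnessLib

/-!
# The unit norm index `[E_K : E_K ∩ N_{L/K} Lˣ]` is `1` for a field of unit rank one: `−1` and ONE non-square unit `ε` being norms suffice
# (no fundamental unit needed), when `[L:K]` is a power of `2`

Topic `NumberTheory/NumberFields` (namespace `Literature.NumberTheory.NumberFields.AmbiguousClass`, next to Chevalley's formula).  THEOREM-ONLY file (no
definition, no named fact, no instance, no `sorry`), written by the prover seat `bsd-line-att-p3` g42 (cell `bsd-f1-sign2`, route `AlignedTransportAtTwo`;
`--supports` stmt-BirchSwinnertonDyer-22298, closes nothing).  It serves the unit-norm-index hypothesis `[E_K : E_K ∩ N_{K_2/K} K_2ˣ] = 1` of the depth door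
(`IwasawaTheory/ClassGroupPRankLeOneOfAmbiguousLayerTwo{,OddIndex}`, this seat) for complex cubic fields (`E_K = ±η^ℤ`): a CERTIFICATE of index one that does not
require knowing that the displayed unit `ε` is fundamental.

THE CRITERION (`relIndex_unitsNorm_eq_one_of_rank_eq_one`).  `K ⊆ L` number fields, `L/K` Galois of degree `2^m`, `[K:ℚ]` odd (so the roots of unity of `K` are
`±1`, Mathlib `NumberField.Units.torsion_eq_one_or_neg_one_of_odd_finrank`) and of unit rank `1` (Dirichlet: `E_K = ±η^ℤ`).  If `−1` and a unit `ε` of `K` are norms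
from `L` (inside `Lˣ`, Chevalley's currency `(⊤).map (Herbrand.norm Gal(L/K))`) and neither `ε` nor `−ε` is the square of a unit of `K`, then
`[E_K : E_K ∩ N_{L/K} Lˣ] = 1`.  PROOF: `ε = ±η^k` with `k` odd; `η^{2^m} = N(η)` is a norm (`pow_finrank_mem_map_norm`); Bézout `ak + b2^m = 1` gives
`η ∈ N`, hence every unit `±η^e` is a norm.

* `exists_unitsMap_eq_of_mem_unitsE_inf_range` — a unit of `𝓞_L` lying in `K` is (the image of) a unit of `𝓞_K` (integral closure).
* `eq_top_of_rank_eq_one` — the group-theoretic core on a subgroup `M ≤ (𝓞 K)ˣ` containing `−1`, all `2^m`-th powers and a unit `ε ∉ ±E_K²`.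
* ★★ `relIndex_unitsNorm_eq_one_of_rank_eq_one` — the criterion.

HONEST SCOPE: classical (Dirichlet's unit theorem + Bézout); nothing specific to any summit; BSD is not advanced by this file.  USE: complex cubic `K = ℚ(β)`
(one real place, unit rank `1`), `L = K_2` the quartic layer (`−1 = N(1 − θ)`, tree `IwasawaTheory.neg_one_mem_map_norm_layer_two`); per seed it remains to
exhibit `ε` as a norm from `K(θ)` and two residue certificates «`±ε` is not a square».

References: [Lang1990] Ch. 13 §4, Lemma 4.1–4.2 (the unit norm index; `E^{[L:K]} ⊆ N`); [NeukirchANT1999] Ch. I §7 (Dirichlet's unit theorem), Ch. I §2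
(integral closure); [Washington1997] §13.3 Prop. 13.22 (the use in `ℤ_p`-towers).
-/

set_option autoImplicit false

noncomputable section

open NumberField NumberField.Units
open scoped nonZeroDivisors

namespace Literature.NumberTheory.NumberFields.AmbiguousClass

open Literature.NumberTheory.GaloisRepresentations Literature.NumberTheory.GaloisRepresentations.Herbrand
  Literature.NumberTheory.GaloisRepresentations.MinkowskiUnit Literature.NumberTheory.GaloisRepresentations.CyclicNormIndex

variable {K L : Type} [Field K] [NumberField K] [Field L] [NumberField L] [Algebra K L]

/-! ## §1 A unit of `𝓞_L` lying in `K` is a unit of `𝓞_K` -/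

omit [NumberField K] [NumberField L] in
/-- **`𝓞_Lˣ ∩ Kˣ = 𝓞_Kˣ`**: an element of `unitsE L ⊓ (Kˣ → Lˣ).range` is the image of a unit of `𝓞 K` (`𝓞_K` is integrally closed in `K`,
Mathlib `isIntegral_algebraMap_iff`). [cite: NeukirchANT1999, Ch. I §2 (integral closure)] -/
theorem exists_unitsMap_eq_of_mem_unitsE_inf_range {x : Lˣ} (hx : x ∈ unitsE L ⊓ (unitsIncl K L).range) :
    ∃ u : (𝓞 K)ˣ, unitsIncl K L (Units.map (algebraMap (𝓞 K) K : 𝓞 K →* K) u) = x := by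
  obtain ⟨⟨y, hy⟩, ⟨k, hk⟩⟩ := hx
  -- `algebraMap K L k = y` and `algebraMap K L k⁻¹ = y⁻¹` are integral over `ℤ`
  have hval : algebraMap K L (k : K) = ((y : 𝓞 L) : L) := by
    have h := congrArg (fun z : Lˣ => (z : L)) (hk.trans hy.symm)
    simpa using h
  have hinv : algebraMap K L ((k⁻¹ : Kˣ) : K) = ((y⁻¹ : (𝓞 L)ˣ) : 𝓞 L) := by
    have h := congrArg (fun z : Lˣ => (z : L)) ((map_inv (unitsIncl K L) k).trans ((congrArg (·⁻¹) (hk.trans hy.symm)).trans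
      (map_inv (Units.map (algebraMap (𝓞 L) L : 𝓞 L →* L)) y).symm))
    simpa using h
  have hint : IsIntegral ℤ (k : K) := by
    rw [← isIntegral_algebraMap_iff (algebraMap K L).injective, hval]
    exact RingOfIntegers.isIntegral_coe _
  have hint' : IsIntegral ℤ ((k⁻¹ : Kˣ) : K) := by
    rw [← isIntegral_algebraMap_iff (algebraMap K L).injective, hinv]
    exact RingOfIntegers.isIntegral_coe _
  refine ⟨⟨⟨(k : K), hint⟩, ⟨((k⁻¹ : Kˣ) : K), hint'⟩, ?_, ?_⟩, ?_⟩
  · apply RingOfIntegers.coe_injective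
    simp
  · apply RingOfIntegers.coe_injective
    simp
  · rw [← hk]
    apply Units.ext
    simp

/-! ## §2 Unit rank one: `−1 ∈ M`, `E^{2^m} ⊆ M`, `ε ∈ M` with `±ε` non-squares ⟹ `M = E` -/

/-- **The group-theoretic core.**  `K` of odd degree (torsion `±1`) and unit rank `1` (`E_K = ±η^ℤ`, Dirichlet); `M ≤ E_K` a subgroup containing `−1`, every
`2^m`-th power, and a unit `ε` such that neither `ε` nor `−ε` is a square.  Then `M = E_K`: `ε = ±η^k` with `k` odd (else `±ε` is a square), `η^{2^m} ∈ M`,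
and Bézout gives `η ∈ M`. [cite: NeukirchANT1999, Ch. I §7 Thm. (7.4) (Dirichlet's unit theorem)] -/
theorem eq_top_of_rank_eq_one (hodd : Odd (Module.finrank ℚ K)) (hrank : rank K = 1) (M : Subgroup (𝓞 K)ˣ)
    (hneg : (-1 : (𝓞 K)ˣ) ∈ M) {m : ℕ} (hpow : ∀ x : (𝓞 K)ˣ, x ^ 2 ^ m ∈ M) {ε : (𝓞 K)ˣ} (hε : ε ∈ M)
    (hnsq : ∀ y : (𝓞 K)ˣ, ε ≠ y ^ 2 ∧ ε ≠ -y ^ 2) : M = ⊤ := by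
  classical
  -- the fundamental unit `η`
  set i0 : Fin (rank K) := ⟨0, by rw [hrank]; exact Nat.zero_lt_one⟩ with hi0
  have huniv : (Finset.univ : Finset (Fin (rank K))) = {i0} := by
    ext i
    simp only [Finset.mem_univ, Finset.mem_singleton, true_iff]
    apply Fin.ext
    have := i.2
    rw [hi0]
    omega
  set η : (𝓞 K)ˣ := fundSystem K i0 with hη
  -- every unit is `±η^e`
  have hrepr : ∀ x : (𝓞 K)ˣ, ∃ e : ℤ, x = η ^ e ∨ x = -η ^ e := by
    intro x
    obtain ⟨⟨ζ, e⟩, hx, -⟩ := exist_unique_eq_mul_prod K x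
    simp only at hx
    rw [huniv, Finset.prod_singleton] at hx
    refine ⟨e i0, ?_⟩
    rcases torsion_eq_one_or_neg_one_of_odd_finrank hodd ζ with h1 | h1
    · left; rw [hx, h1, one_mul]
    · right; rw [hx, h1, neg_one_mul]
  -- `ε = ±η^k` with `k` odd, so `η^k ∈ M`
  obtain ⟨k, hk⟩ := hrepr ε
  have hηk : η ^ k ∈ M := by
    rcases hk with h | h
    · rw [← h]; exact hε
    · have : η ^ k = -1 * ε := by rw [h]; simp
      rw [this]; exact M.mul_mem hneg hε
  have hkodd : Odd k := by
    by_contra heven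
    rw [Int.not_odd_iff_even] at heven
    obtain ⟨j, rfl⟩ := heven
    have hsq : η ^ (j + j) = (η ^ j) ^ 2 := by rw [← two_mul, mul_comm, zpow_mul, zpow_two, pow_two]
    rcases hk with h | h
    · exact (hnsq (η ^ j)).1 (h.trans hsq)
    · exact (hnsq (η ^ j)).2 (by rw [h, hsq])
  -- Bézout: `η ∈ M`
  have hηM : η ∈ M := by
    have hgcd : Int.gcd k (2 ^ m : ℕ) = 1 := by
      have hk2 : Nat.Coprime k.natAbs 2 := Nat.coprime_two_right.mpr (Int.natAbs_odd.mpr hkodd)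
      rw [Int.gcd_eq_natAbs, Int.natAbs_natCast]
      exact hk2.pow_right m
    have hbez := Int.gcd_eq_gcd_ab k (2 ^ m : ℕ)
    rw [hgcd] at hbez
    have h1 : η = (η ^ k) ^ Int.gcdA k (2 ^ m : ℕ) * (η ^ 2 ^ m) ^ Int.gcdB k (2 ^ m : ℕ) := by
      rw [← zpow_natCast η (2 ^ m), ← zpow_mul, ← zpow_mul, ← zpow_add]
      push_cast at hbez ⊢
      rw [← hbez, zpow_one]
    rw [h1]
    exact M.mul_mem (M.zpow_mem hηk _) (M.zpow_mem (hpow η) _)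
  -- conclude
  rw [eq_top_iff]
  intro x _
  obtain ⟨e, he⟩ := hrepr x
  rcases he with h | h
  · rw [h]; exact M.zpow_mem hηM e
  · rw [h, show -η ^ e = -1 * η ^ e by simp]
    exact M.mul_mem hneg (M.zpow_mem hηM e)

/-! ## §3 The criterion -/

/-- ★★ **Unit norm index one from `−1` and ONE non-square unit.**  `L/K` Galois of degree `2^m`, `[K:ℚ]` odd, unit rank of `K` equal to `1`; if `−1` and a unit
`ε` of `K` are norms from `L` (as elements of `Lˣ`: in the image of `Herbrand.norm Gal(L/K)`) and neither `ε` nor `−ε` is the square of a unit of `K`, then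
**`[E_K : E_K ∩ N_{L/K} Lˣ] = 1`** in Chevalley's currency (`E_K = 𝓞_Lˣ ∩ Kˣ ≤ Lˣ`).  With `E^{[L:K]} ⊆ N` (`pow_finrank_mem_map_norm`) and §§1–2.
[cite: Lang1990, Ch. 13 §4, Lemma 4.1–4.2 (PDF pp. 203–204)] [cite: NeukirchANT1999, Ch. I §7 Thm. (7.4)] -/
theorem relIndex_unitsNorm_eq_one_of_rank_eq_one [IsGalois K L] (hodd : Odd (Module.finrank ℚ K)) (hrank : rank K = 1)
    (hd : ∃ m : ℕ, Module.finrank K L = 2 ^ m) {ε : (𝓞 K)ˣ}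
    (hε : unitsIncl K L (Units.map (algebraMap (𝓞 K) K : 𝓞 K →* K) ε) ∈ (⊤ : Subgroup Lˣ).map (Herbrand.norm (L ≃ₐ[K] L)))
    (hneg : unitsIncl K L (-1) ∈ (⊤ : Subgroup Lˣ).map (Herbrand.norm (L ≃ₐ[K] L)))
    (hnsq : ∀ y : (𝓞 K)ˣ, ε ≠ y ^ 2 ∧ ε ≠ -y ^ 2) :
    (unitsE L ⊓ (⊤ : Subgroup Lˣ).map (Herbrand.norm (L ≃ₐ[K] L))).relIndex (unitsE L ⊓ (unitsIncl K L).range) = 1 := by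
  classical
  obtain ⟨m, hm⟩ := hd
  -- `φ : E_K → Lˣ`
  set φ : (𝓞 K)ˣ →* Lˣ := (unitsIncl K L).comp (Units.map (algebraMap (𝓞 K) K : 𝓞 K →* K)) with hφ
  have hφE : ∀ u : (𝓞 K)ˣ, φ u ∈ unitsE L := by
    intro u
    refine ⟨Units.map (algebraMap (𝓞 K) (𝓞 L) : 𝓞 K →* 𝓞 L) u, ?_⟩
    apply Units.ext
    simp only [hφ, MonoidHom.coe_comp, Function.comp_apply, Units.coe_map, MonoidHom.coe_coe]
    exact (IsScalarTower.algebraMap_apply (𝓞 K) (𝓞 L) L (u : 𝓞 K)).symm.trans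
      (IsScalarTower.algebraMap_apply (𝓞 K) K L (u : 𝓞 K))
  have hφK : ∀ u : (𝓞 K)ˣ, φ u ∈ (unitsIncl K L).range := fun u => ⟨_, rfl⟩
  set M : Subgroup (𝓞 K)ˣ := (unitsE L ⊓ (⊤ : Subgroup Lˣ).map (Herbrand.norm (L ≃ₐ[K] L))).comap φ with hM
  have hMtop : M = ⊤ := by
    refine eq_top_of_rank_eq_one hodd hrank M ?_ (m := m) (fun x => ?_) (ε := ε) ?_ hnsq
    · refine ⟨hφE _, ?_⟩
      have : φ (-1) = unitsIncl K L (-1) := by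
        rw [hφ, MonoidHom.comp_apply]
        congr 1
      rw [this]; exact hneg
    · refine ⟨hφE _, ?_⟩
      rw [map_pow, ← hm]
      exact pow_finrank_mem_map_norm (hφK x)
    · exact ⟨hφE _, hε⟩
  -- the index
  rw [Subgroup.relIndex_eq_one]
  intro x hx
  obtain ⟨u, rfl⟩ := exists_unitsMap_eq_of_mem_unitsE_inf_range hx
  have hu : u ∈ M := by rw [hMtop]; exact Subgroup.mem_top u
  exact hu

end Literature.NumberTheory.NumberFields.AmbiguousClass

end
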